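import Mathlib
import HarnessLib
import Summits.HubbardSuperconductivity.HubbardSuperconductivity.Theorems.KLProgrammeKLRegimeFlowReadScaleZeroChainSymbol

/-!
# Route `KLProgramme`, crux K3 — gen-8 ENGINE-FLOW child (stmt-HubbardSuperconductivity-20437 `KLRegimeEngineV17F2`), stub (C) at `n = 0`,
# located item #22a «(C)-SCALE0-PT2», step (π2b): THE CHAIN-SUBTRACTED SPLIT `W₀ = W_a + W_chain` — `W_chain`'s momentum self-energy is
# `−(U²t₀²/(βL²))·Ψ⁰(K,σ)` EXACTLY, its grid kernel is the Hartree-chain term of π1b, and `W_a := W₀ − W_chain` has the PURE SUNSET off the diagonal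

Seat hubbard-kl-k3c5-p1 (g13; owner of #22a).  Inputs: π1b `kernel_two_scaleZero_effAction_offDiag` (p610302), π2a `selfEnergy_map_gridSub_pullbackQuadratic`
(p611402).  For a coefficient `c : ℂ` put `Q_c := Σ_{p,q,σ} (c·A((q,σ)⁺,(p,σ)⁻)) • ψ⁺_{pσ}ψ⁻_{qσ}` on the `4M`-grid, `A = contr (S_{4M}ᵀC⁰_{>e₀}S_{4M})`; the Hartree chain of
`W₀` is `W_chain = Q_c` at `c = (Uβ/4M)²·t₀²`, `t₀ = −Σ_k(βL²)⁻²Ψ⁰(k)` (`contr_scaleZeroGridCov_samePoint`).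

* §1 `contr_scaleZeroGridCov_eq_neg` — `A(X,Y) = −(S_{4M}ᵀC⁰_{>e₀}S_{4M})(X,Y)` (antisymmetry of `C⁰_{>e₀}`);
* §2 **`selfEnergy_map_gridSub_chainQuadratic`** — `Σ[map S_{4M} Q_c](K,σ) = −c·((4M)²/(β³L²))·Ψ⁰(K,σ)` (`β ≠ 0`): the chain's momentum symbol is the UV
  symbol itself — a function of `(ω, e(k⃗))` only;
* §3 `kernel_two_chainQuadratic` — `kernel₂ Q_c ((p,σ,+),(q,σ,−)) = ½·c·A((q,σ)⁺,(p,σ)⁻)` at EVERY pair of grid points;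
* §4 **`kernel_two_scaleZero_effAction_sub_chain_offDiag`** — for `p ≠ q`:
  `kernel₂ (W₀ − W_chain) ((p,σ,+),(q,σ,−)) = −½(Uβ/4M)²·A(qσ⁺,pσ⁻)A(pσ̄⁺,qσ̄⁻)A(qσ̄⁺,pσ̄⁻) + kernel₂ R₃ (…)` — the PURE SUNSET plus the Literature's
  order-`≥ 3` remainder: the `W_a`-input of k3c3-p1's MIXED door (p608958), whose off-site moments are the natural numbers `½·bS_k` of SCALE0-PT2-SIZING.

Pure algebra; no definitions (the chain element is written out); nothing about sizes; nothing asserts any stub of 20437, K3 or superconductivity.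
References: BGM 2006 §2.1–2.2 [cite: BenfattoGiulianiMastropietro2006]; Salmhofer 1999 §4.3 [cite: Salmhofer1999].
-/

noncomputable section

namespace Summit.HubbardSuperconductivity.HubbardSuperconductivity.Theorems.KLRegimeSplit

set_option linter.dupNamespace false -- summit = problem name (single-conjunct summit), D-0017

open Literature.MathematicalPhysics.QuantumLattice Literature.Probability.LatticeModels GrassmannAlgebra Finset Matrix
open Summit.HubbardSuperconductivity.HubbardSuperconductivity.Theorems.EngineV8
open Summit.HubbardSuperconductivity.HubbardSuperconductivity.Theorems.TwoLegFourier (selfEnergy_finset_sum)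

variable {L M : ℕ} [NeZero L]

/-! ## §1 Antisymmetry: `contr = −entry` for the scale-`0` grid covariance -/

/-- **`A(X,Y) = −(S_{4M}ᵀC⁰_{>e₀}S_{4M})(X,Y)`**: the pulled-back UV covariance is antisymmetric, so its contraction is minus its entry. -/
theorem contr_scaleZeroGridCov_eq_neg (β μ : ℝ) (X Y : GridLeg (GridPoint L (2 * (2 * M)))) :
    contr ℂ ((hubbardGridSub L M β (2 * (2 * M))).transpose * hubbardCovAboveCT L M β μ 0 0 klE0 * hubbardGridSub L M β (2 * (2 * M))) X Y =
      -((hubbardGridSub L M β (2 * (2 * M))).transpose * hubbardCovAboveCT L M β μ 0 0 klE0 * hubbardGridSub L M β (2 * (2 * M))) X Y := by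
  set S := hubbardGridSub L M β (2 * (2 * M)) with hS
  have hT : (S.transpose * hubbardCovAboveCT L M β μ 0 0 klE0 * S).transpose = -(S.transpose * hubbardCovAboveCT L M β μ 0 0 klE0 * S) := by
    rw [Matrix.transpose_mul, Matrix.transpose_mul, Matrix.transpose_transpose, hubbardCovAboveCT_transpose, Matrix.neg_mul, Matrix.mul_neg,
      ← Matrix.mul_assoc]
  have hYX : (S.transpose * hubbardCovAboveCT L M β μ 0 0 klE0 * S) Y X = -(S.transpose * hubbardCovAboveCT L M β μ 0 0 klE0 * S) X Y := by
    have h := congrFun (congrFun hT X) Y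
    rwa [Matrix.transpose_apply, Matrix.neg_apply] at h
  rw [contr_apply, hYX, Rat.smul_one_eq_cast]
  push_cast
  ring

/-! ## §2 The chain's momentum self-energy -/

/-- **`Σ[map S_{4M} Q_c](K,σ) = −c·((4M)²/(β³L²))·Ψ⁰(K,σ)`** for the covariance-weighted grid quadratic `Q_c = Σ_{p,q,σ'} (c·A((q,σ')⁺,(p,σ')⁻)) • ψ⁺_{pσ'}ψ⁻_{qσ'}`
(`β ≠ 0`; `A = contr`, `Ψ⁰ = uvSymbolCT … 0 klE0`). -/
theorem selfEnergy_map_gridSub_chainQuadratic [NeZero M] {β : ℝ} (hβ : β ≠ 0) (μ : ℝ) (c : ℂ) (K : FreqMomentum L M) (σ : Fin 2) :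
    selfEnergy L M β (ExteriorAlgebra.map (Matrix.toLin' (hubbardGridSub L M β (2 * (2 * M))))
        (∑ p : GridPoint L (2 * (2 * M)), ∑ q : GridPoint L (2 * (2 * M)), ∑ σ' : Fin 2,
          (c * contr ℂ ((hubbardGridSub L M β (2 * (2 * M))).transpose * hubbardCovAboveCT L M β μ 0 0 klE0 *
              hubbardGridSub L M β (2 * (2 * M))) (((q, σ'), 0) : GridLeg (GridPoint L (2 * (2 * M)))) ((p, σ'), 1)) •
            (gen ℂ (((p, σ'), 0) : GridLeg (GridPoint L (2 * (2 * M)))) * gen ℂ (((q, σ'), 1) : GridLeg (GridPoint L (2 * (2 * M))))))) K σ =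
      -c * ((((2 * (2 * M) : ℕ) : ℂ) ^ 2 / (β ^ 3 * (L : ℝ) ^ 2 : ℝ)) : ℂ) * uvSymbolCT L M β μ 0 klE0 (K, σ) := by
  haveI : NeZero (2 * (2 * M)) := ⟨by have := NeZero.ne M; omega⟩
  have hN : 2 * M ≤ 2 * (2 * M) := by omega
  -- `Q_c = (−c) • (the entry-weighted quadratic)`
  have hQ : (∑ p : GridPoint L (2 * (2 * M)), ∑ q : GridPoint L (2 * (2 * M)), ∑ σ' : Fin 2,
      (c * contr ℂ ((hubbardGridSub L M β (2 * (2 * M))).transpose * hubbardCovAboveCT L M β μ 0 0 klE0 *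
          hubbardGridSub L M β (2 * (2 * M))) (((q, σ'), 0) : GridLeg (GridPoint L (2 * (2 * M)))) ((p, σ'), 1)) •
        (gen ℂ (((p, σ'), 0) : GridLeg (GridPoint L (2 * (2 * M)))) * gen ℂ (((q, σ'), 1) : GridLeg (GridPoint L (2 * (2 * M)))))) =
      (-c) • ∑ p : GridPoint L (2 * (2 * M)), ∑ q : GridPoint L (2 * (2 * M)), ∑ σ' : Fin 2,
        ((hubbardGridSub L M β (2 * (2 * M))).transpose * normalCovariance L M (uvSymbolCT L M β μ 0 klE0) * hubbardGridSub L M β (2 * (2 * M)))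
            (((q, σ'), 0) : GridLeg (GridPoint L (2 * (2 * M)))) ((p, σ'), 1) •
          (gen ℂ (((p, σ'), 0) : GridLeg (GridPoint L (2 * (2 * M)))) * gen ℂ (((q, σ'), 1) : GridLeg (GridPoint L (2 * (2 * M))))) := by
    simp only [Finset.smul_sum, smul_smul]
    refine Finset.sum_congr rfl fun p _ => Finset.sum_congr rfl fun q _ => Finset.sum_congr rfl fun σ' _ => ?_
    rw [contr_scaleZeroGridCov_eq_neg, hubbardCovAboveCT_zero_seed_eq_normalCovariance_uvSymbolCT]
    ring_nf
  rw [hQ, map_smul, selfEnergy_smul', selfEnergy_map_gridSub_pullbackQuadratic hβ hN]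
  ring

/-! ## §3 The chain's grid kernel -/

/-- **`kernel₂ Q_c ((p,σ,+),(q,σ,−)) = ½·c·A((q,σ)⁺,(p,σ)⁻)`** at every pair of grid points. -/
theorem kernel_two_chainQuadratic (β μ : ℝ) (c : ℂ) (p q : GridPoint L (2 * (2 * M))) (σ : Fin 2) :
    kernel ℂ (∑ p' : GridPoint L (2 * (2 * M)), ∑ q' : GridPoint L (2 * (2 * M)), ∑ σ' : Fin 2,
          (c * contr ℂ ((hubbardGridSub L M β (2 * (2 * M))).transpose * hubbardCovAboveCT L M β μ 0 0 klE0 *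
              hubbardGridSub L M β (2 * (2 * M))) (((q', σ'), 0) : GridLeg (GridPoint L (2 * (2 * M)))) ((p', σ'), 1)) •
            (gen ℂ (((p', σ'), 0) : GridLeg (GridPoint L (2 * (2 * M)))) * gen ℂ (((q', σ'), 1) : GridLeg (GridPoint L (2 * (2 * M))))))
        2 (fun i => ((![p, q] i, σ), i)) =
      (2 : ℂ)⁻¹ * (c * contr ℂ ((hubbardGridSub L M β (2 * (2 * M))).transpose * hubbardCovAboveCT L M β μ 0 0 klE0 *
        hubbardGridSub L M β (2 * (2 * M))) (((q, σ), 0) : GridLeg (GridPoint L (2 * (2 * M)))) ((p, σ), 1)) := by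
  rw [twoLegString_eq]
  simp only [kernel_sum, kernel_smul, kernel_two_gen_mul_gen, Matrix.cons_val_zero, Matrix.cons_val_one, Prod.mk.injEq, and_true,
    zero_ne_one, and_false, if_false, one_ne_zero, mul_zero, sub_zero]
  -- collapse `p' = p`, `q' = q`, `σ' = σ`
  rw [Finset.sum_eq_single_of_mem p (Finset.mem_univ _) (fun p' _ hp' => by
        have h : ¬p = p' := fun h => hp' h.symm
        simp only [h, false_and, if_false, zero_mul, mul_zero, Finset.sum_const_zero]),
    Finset.sum_eq_single_of_mem q (Finset.mem_univ _) (fun q' _ hq' => by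
        have h : ¬q = q' := fun h => hq' h.symm
        simp only [h, false_and, if_false, mul_zero, Finset.sum_const_zero]),
    Finset.sum_eq_single_of_mem σ (Finset.mem_univ _) (fun σ' _ hσ' => by
        have h : ¬σ = σ' := fun h => hσ' h.symm
        simp only [h, and_false, if_false, mul_zero])]
  simp only [and_self, if_true, mul_one]
  ring

/-! ## §4 `W_a := W₀ − W_chain` has the pure sunset off the diagonal -/

/-- **THE `W_a`-KERNEL OF THE SPLIT OF RECORD**: with `W_chain := Q_c`, `c = (Uβ/4M)²·t₀·t₀`, `t₀ = −Σ_k(βL²)⁻²Ψ⁰(k)`, for grid points `p ≠ q` and every spin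
`kernel₂ (W₀ − W_chain) ((p,σ,+),(q,σ,−)) = −½(Uβ/4M)²·A(qσ⁺,pσ⁻)·A(pσ̄⁺,qσ̄⁻)·A(qσ̄⁺,pσ̄⁻) + kernel₂ R₃ ((p,σ,+),(q,σ,−))` — SUNSET + order-`≥ 3` remainder. -/
theorem kernel_two_scaleZero_effAction_sub_chain_offDiag [NeZero M] (β U μ : ℝ) (p q : GridPoint L (2 * (2 * M))) (hpq : p ≠ q) (σ : Fin 2) :
    kernel ℂ (effAction ℂ ((hubbardGridSub L M β (2 * (2 * M))).transpose * hubbardCovAboveCT L M β μ 0 0 klE0 *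
          hubbardGridSub L M β (2 * (2 * M))) (hubbardGridInteraction L (2 * (2 * M)) β U) -
        ∑ p' : GridPoint L (2 * (2 * M)), ∑ q' : GridPoint L (2 * (2 * M)), ∑ σ' : Fin 2,
          ((((U * (β / (2 * (2 * M) : ℕ)) : ℝ) : ℂ) ^ 2 *
              ((-∑ k : FreqMomentum L M, ((1 / (β * (L : ℝ) ^ 2) : ℝ) : ℂ) ^ 2 * uvSymbolCT L M β μ 0 klE0 (k, 0)) *
               (-∑ k : FreqMomentum L M, ((1 / (β * (L : ℝ) ^ 2) : ℝ) : ℂ) ^ 2 * uvSymbolCT L M β μ 0 klE0 (k, 0)))) *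
            contr ℂ ((hubbardGridSub L M β (2 * (2 * M))).transpose * hubbardCovAboveCT L M β μ 0 0 klE0 *
              hubbardGridSub L M β (2 * (2 * M))) (((q', σ'), 0) : GridLeg (GridPoint L (2 * (2 * M)))) ((p', σ'), 1)) •
            (gen ℂ (((p', σ'), 0) : GridLeg (GridPoint L (2 * (2 * M)))) * gen ℂ (((q', σ'), 1) : GridLeg (GridPoint L (2 * (2 * M)))))) 2
        (fun i => ((![p, q] i, σ), i)) =
      -(2 : ℂ)⁻¹ * (((U * (β / (2 * (2 * M) : ℕ)) : ℝ) : ℂ) ^ 2 *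
        (contr ℂ ((hubbardGridSub L M β (2 * (2 * M))).transpose * hubbardCovAboveCT L M β μ 0 0 klE0 *
            hubbardGridSub L M β (2 * (2 * M))) (((q, σ), 0) : GridLeg (GridPoint L (2 * (2 * M)))) ((p, σ), 1) *
          (contr ℂ ((hubbardGridSub L M β (2 * (2 * M))).transpose * hubbardCovAboveCT L M β μ 0 0 klE0 *
                hubbardGridSub L M β (2 * (2 * M))) (((p, σ.rev), 0) : GridLeg (GridPoint L (2 * (2 * M)))) ((q, σ.rev), 1) *
              contr ℂ ((hubbardGridSub L M β (2 * (2 * M))).transpose * hubbardCovAboveCT L M β μ 0 0 klE0 *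
                hubbardGridSub L M β (2 * (2 * M))) (((q, σ.rev), 0) : GridLeg (GridPoint L (2 * (2 * M)))) ((p, σ.rev), 1)))) +
      kernel ℂ (effAction ℂ ((hubbardGridSub L M β (2 * (2 * M))).transpose * hubbardCovAboveCT L M β μ 0 0 klE0 *
            hubbardGridSub L M β (2 * (2 * M))) (hubbardGridInteraction L (2 * (2 * M)) β U) -
          gaussConv ℂ ((hubbardGridSub L M β (2 * (2 * M))).transpose * hubbardCovAboveCT L M β μ 0 0 klE0 *
            hubbardGridSub L M β (2 * (2 * M))) (hubbardGridInteraction L (2 * (2 * M)) β U) +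
        (2 : ℂ)⁻¹ • (gaussConv ℂ ((hubbardGridSub L M β (2 * (2 * M))).transpose * hubbardCovAboveCT L M β μ 0 0 klE0 *
              hubbardGridSub L M β (2 * (2 * M))) (hubbardGridInteraction L (2 * (2 * M)) β U * hubbardGridInteraction L (2 * (2 * M)) β U) -
          gaussConv ℂ ((hubbardGridSub L M β (2 * (2 * M))).transpose * hubbardCovAboveCT L M β μ 0 0 klE0 *
              hubbardGridSub L M β (2 * (2 * M))) (hubbardGridInteraction L (2 * (2 * M)) β U) *
            gaussConv ℂ ((hubbardGridSub L M β (2 * (2 * M))).transpose * hubbardCovAboveCT L M β μ 0 0 klE0 *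
              hubbardGridSub L M β (2 * (2 * M))) (hubbardGridInteraction L (2 * (2 * M)) β U))) 2
        (fun i => ((![p, q] i, σ), i)) := by
  rw [kernel_sub_apply, kernel_two_scaleZero_effAction_offDiag β U μ p q hpq σ, kernel_two_chainQuadratic]
  ring

end Summit.HubbardSuperconductivity.HubbardSuperconductivity.Theorems.KLRegimeSplit

end
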